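import Mathlib
import Literature.Combinatorics.Additive.TripleProductProperty
import Summits.MatrixMultiplication.MatrixMultiplication.Theorems.HyperoctahedralThreshold.Negative.SubgroupPivotSieve

/-!
# `ThresholdSubsetTriples` (crux stmt-MatrixMultiplication-10882): no set of a threshold triple fills half of a
# subgroup coset — and the quotient-subgroup interface to the Wedderburn sieve

Negative-side helper (line lead c2, 2026-08-17; `sorry`-free, standard axioms).  The subgroup-pivot sieve
(`HyperoctahedralThreshold.Negative.conceded_subgroup_cap`, p86923: `TPP(H, T, U)` with `H ≤ S_n` a whole subgroup
⇒ `|H||T||U| ≤ n!·d_max(S_n) ≤ (n!)^{3/2}e^{-(c₂/2)√n}`, `c₂ = vkUpperConst`) kills triples one of whose sets IS a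
subgroup (`Negative.not_thresholdSubgroupMemberTriples`, p139094).  The crux-strategist's census v2 (N1′) records
that ONE dense subset of a subgroup coset among three otherwise free sets "is excluded by nothing in the tree
(the coset cap needs a full coset, the sieve a full subgroup, group packing all three hosted)".  This file supplies
the missing step in the only generality in which it is elementary, and isolates the interface for the rest:

* `tpp_of_quotients_cover` — **quotient-cover transfer** (any group): if `TPP(S, T, U)` and every quotient
  `x x'⁻¹` of `S₀` is a quotient `s s'⁻¹` of `S`, then `TPP(S₀, T, U)`.  In particular a SUBGROUP `H ⊆ S·S⁻¹`
  may replace `S` (`tpp_subgroup_of_quotients_cover`).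
* `quotients_cover_of_dense` — `S ⊆ H`, `|H| < 2|S|` ⇒ `S·S⁻¹ = H` (pigeonhole: `S ∩ hS ≠ ∅`).
* `quotSubgroup_cap` — **the interface**: for `n ≥ n₀`, `TPP(S, T, U)` in `S_n` and a subgroup `H ⊆ S·S⁻¹` give
  `|H|·|T|·|U| ≤ (n!)^{3/2}e^{-(c₂/2)√n}`, i.e. volume `≤ (|S|/|H|)·(n!)^{3/2}e^{-(c₂/2)√n}`: any future lemma
  putting a subgroup of order `≥ |S|e^{-ε√n}` inside the quotient set of a hosted witness (a non-abelian
  Bogolyubov statement for the host) kills that host family at every `c < c₂/2 − ε`.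
* `denseMember_cap` — for `n ≥ n₀`: `S ⊆ H·a` with `|H| < 2|S|` and `TPP(S, T, U)` ⇒
  `|S||T||U| ≤ (n!)^{3/2}e^{-(c₂/2)√n}`; `not_thresholdDenseMemberTriples` — the design family "threshold
  triples one of whose sets fills more than half of a right coset of a subgroup" is empty (for left cosets `a·H`
  conjugate the whole triple by `a⁻¹`; for the other two slots rotate, `TripleProductProperty.rotate`).

Density `> 1/2` is sharp for THIS argument (a subgroup of index 2 in `H` has density `1/2` and quotient set `≠ H`);
below `1/2` the quotient set need not contain `H` and `quotSubgroup_cap` is the statement to feed.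

References: Cohn–Umans 2003 §1.3, Def. 2.1; Blasiak–Church–Cohn–Grochow–Umans 2017 (arXiv:1712.02302) §4;
Vershik–Kerov 1985 (tree `VershikKerov1985_maxCharDegree_holds`); crux workfile `STRATEGY-CENSUS.md` v2 §N1′.
-/

set_option linter.dupNamespace false

namespace Summit.MatrixMultiplication.MatrixMultiplication.Theorems.ThresholdSubsetTriples.Negative

open Literature.Combinatorics.Additive
open Literature.RepresentationTheory.FiniteGroups
open Summit.MatrixMultiplication.MatrixMultiplication.Theorems.HyperoctahedralThreshold.Negative
  (conceded_subgroup_cap)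

section AnyGroup

variable {G : Type*} [Group G] [DecidableEq G]

omit [DecidableEq G] in
/-- **Quotient-cover transfer.**  If `(S, T, U)` has the TPP and every quotient `x x'⁻¹` of `S₀` is a quotient
`s s'⁻¹` of `S`, then `(S₀, T, U)` has the TPP: a relation `x x'⁻¹ (t t'⁻¹)(u u'⁻¹) = 1` rewrites as the
`S`-relation `s s'⁻¹ (t t'⁻¹)(u u'⁻¹) = 1`, whence `s = s'`, so `x x'⁻¹ = 1`. -/
theorem tpp_of_quotients_cover {S₀ S T U : Finset G} (hT : TripleProductProperty S T U)
    (hcover : ∀ x ∈ S₀, ∀ x' ∈ S₀, ∃ s ∈ S, ∃ s' ∈ S, s * s'⁻¹ = x * x'⁻¹) :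
    TripleProductProperty S₀ T U := by
  intro x hx x' hx' t ht t' ht' u hu u' hu' he
  obtain ⟨s, hs, s', hs', hq⟩ := hcover x hx x' hx'
  obtain ⟨h1, h2, h3⟩ := hT s hs s' hs' t ht t' ht' u hu u' hu' (by rw [hq]; exact he)
  refine ⟨?_, h2, h3⟩
  have h1' : x * x'⁻¹ = 1 := by rw [← hq, h1, mul_inv_cancel]
  exact mul_inv_eq_one.1 h1'

omit [DecidableEq G] in
/-- A subgroup inside the quotient set may replace the first set: `TPP(S, T, U)`, `H ⊆ S·S⁻¹`, `S₀ ⊆ H` ⇒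
`TPP(S₀, T, U)`. -/
theorem tpp_subgroup_of_quotients_cover (H : Subgroup G) {S₀ S T U : Finset G}
    (hT : TripleProductProperty S T U) (hS₀ : ∀ x ∈ S₀, x ∈ H)
    (hcover : ∀ h ∈ H, ∃ s ∈ S, ∃ s' ∈ S, s * s'⁻¹ = h) : TripleProductProperty S₀ T U :=
  tpp_of_quotients_cover hT fun x hx x' hx' =>
    hcover (x * x'⁻¹) (H.mul_mem (hS₀ x hx) (H.inv_mem (hS₀ x' hx')))

/-- **Dense subsets have full quotient set.**  `S ⊆ H` with `|H| < 2|S|` ⇒ every `h ∈ H` is a quotient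
`s s'⁻¹` (`s, s' ∈ S`): the sets `S` and `hS` of size `|S|` inside `H` must meet. -/
theorem quotients_cover_of_dense [Fintype G] (H : Subgroup G) [DecidablePred (· ∈ H)] {S : Finset G}
    (hS : ∀ s ∈ S, s ∈ H) (hdense : Nat.card H < 2 * S.card) :
    ∀ h ∈ H, ∃ s ∈ S, ∃ s' ∈ S, s * s'⁻¹ = h := by
  intro h hh
  classical
  set Hf : Finset G := Finset.univ.filter (· ∈ H) with hHf
  have hHcard : Hf.card = Nat.card H := (Nat.subtype_card Hf (fun x => by simp [hHf])).symm
  have hinj : Function.Injective (fun x : G => h * x) := mul_right_injective h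
  by_contra hno
  push Not at hno
  have hdisj : Disjoint S (S.image (fun x => h * x)) := by
    rw [Finset.disjoint_left]
    rintro y hy hy'
    obtain ⟨s', hs', rfl⟩ := Finset.mem_image.1 hy'
    exact hno _ hy s' hs' (by group)
  have hsub : S ∪ S.image (fun x => h * x) ⊆ Hf := by
    intro y hy
    rcases Finset.mem_union.1 hy with hy | hy
    · simpa [hHf] using hS y hy
    · obtain ⟨s', hs', rfl⟩ := Finset.mem_image.1 hy
      simpa [hHf] using H.mul_mem hh (hS s' hs')
  have hcard := Finset.card_le_card hsub
  rw [Finset.card_union_of_disjoint hdisj, Finset.card_image_of_injective _ hinj, hHcard] at hcard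
  omega

/-- Right translation of the first set preserves the TPP (its quotients `(s a)(s' a)⁻¹ = s s'⁻¹` are unchanged). -/
theorem tpp_image_mulRight_first {S T U : Finset G} (hT : TripleProductProperty S T U) (a : G) :
    TripleProductProperty (S.image (· * a)) T U := by
  intro x hx x' hx' t ht t' ht' u hu u' hu' he
  obtain ⟨s, hs, rfl⟩ := Finset.mem_image.1 hx
  obtain ⟨s', hs', rfl⟩ := Finset.mem_image.1 hx'
  have he' : s * s'⁻¹ * (t * t'⁻¹) * (u * u'⁻¹) = 1 := by
    have : s * a * (s' * a)⁻¹ = s * s'⁻¹ := by group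
    rwa [this] at he
  obtain ⟨h1, h2, h3⟩ := hT s hs s' hs' t ht t' ht' u hu u' hu' he'
  exact ⟨by rw [h1], h2, h3⟩

end AnyGroup

/-- **Quotient-subgroup cap (interface to the sieve).**  For `n ≥ n₀`: if `(S, T, U)` is a TPP triple in `S_n` and
the subgroup `H` lies inside the quotient set `S·S⁻¹`, then `|H|·|T|·|U| ≤ (n!)^{3/2}·e^{-(c₂/2)√n}` — so the volume
is at most `(|S|/|H|)·(n!)^{3/2}e^{-(c₂/2)√n}`.  (`TPP(H, T, U)` by `tpp_subgroup_of_quotients_cover`, then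
`conceded_subgroup_cap`.) -/
theorem quotSubgroup_cap : ∃ n₀ : ℕ, ∀ n ≥ n₀, ∀ (H : Subgroup (Equiv.Perm (Fin n))) (S T U : Finset (Equiv.Perm (Fin n))), (∀ h ∈ H, ∃ s ∈ S, ∃ s' ∈ S, s * s'⁻¹ = h) → TripleProductProperty S T U → ((Nat.card H * T.card * U.card : ℕ) : ℝ) ≤ (n.factorial : ℝ) ^ ((3 : ℝ) / 2) * Real.exp (-(vkUpperConst / 2 * Real.sqrt (n : ℝ))) := by
  obtain ⟨n₀, hcap⟩ := conceded_subgroup_cap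
  refine ⟨n₀, fun n hn H S T U hcover hT => ?_⟩
  classical
  set Hf : Finset (Equiv.Perm (Fin n)) := Finset.univ.filter (· ∈ H) with hHf
  have hmem : ∀ x, x ∈ Hf ↔ x ∈ H := fun x => by simp [hHf]
  have hHcard : Hf.card = Nat.card H := (Nat.subtype_card Hf hmem).symm
  have hT' : TripleProductProperty Hf T U :=
    tpp_subgroup_of_quotients_cover H hT (fun x hx => (hmem x).1 hx) hcover
  have h := hcap n hn H Hf T U hmem hT'
  rwa [hHcard] at h

/-- **Dense-member cap.**  For `n ≥ n₀`: a TPP triple `(S, T, U)` in `S_n` whose first set lies in a right coset `H·a`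
of a subgroup and fills MORE THAN HALF of it (`|H| < 2|S|`) has volume `|S||T||U| ≤ (n!)^{3/2}·e^{-(c₂/2)√n}`.
Proof: translate `S ↦ S a⁻¹ ⊆ H` (`tpp_image_mulRight_first`), `S a⁻¹ (S a⁻¹)⁻¹ = H` by `quotients_cover_of_dense`,
then `quotSubgroup_cap` and `|S| ≤ |H|`. -/
theorem denseMember_cap : ∃ n₀ : ℕ, ∀ n ≥ n₀, ∀ (H : Subgroup (Equiv.Perm (Fin n))) (a : Equiv.Perm (Fin n)) (S T U : Finset (Equiv.Perm (Fin n))), (∀ s ∈ S, s * a⁻¹ ∈ H) → Nat.card H < 2 * S.card → TripleProductProperty S T U → ((S.card * T.card * U.card : ℕ) : ℝ) ≤ (n.factorial : ℝ) ^ ((3 : ℝ) / 2) * Real.exp (-(vkUpperConst / 2 * Real.sqrt (n : ℝ))) := by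
  obtain ⟨n₀, hcap⟩ := quotSubgroup_cap
  refine ⟨n₀, fun n hn H a S T U hS hdense hT => ?_⟩
  classical
  set S' : Finset (Equiv.Perm (Fin n)) := S.image (· * a⁻¹) with hS'
  have hinj : Function.Injective (fun x : Equiv.Perm (Fin n) => x * a⁻¹) := mul_left_injective a⁻¹
  have hS'card : S'.card = S.card := Finset.card_image_of_injective _ hinj
  have hS'H : ∀ s ∈ S', s ∈ H := by
    intro s hs
    obtain ⟨x, hx, rfl⟩ := Finset.mem_image.1 hs
    exact hS x hx
  have hdense' : Nat.card H < 2 * S'.card := by rwa [hS'card]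
  have hcover := quotients_cover_of_dense H hS'H hdense'
  have hTS' : TripleProductProperty S' T U := tpp_image_mulRight_first hT a⁻¹
  have key := hcap n hn H S' T U hcover hTS'
  -- `|S| ≤ |H|`: `S' ⊆ H` injectively
  have hSH : S.card ≤ Nat.card H := by
    set Hf : Finset (Equiv.Perm (Fin n)) := Finset.univ.filter (· ∈ H) with hHf
    have hHcard : Hf.card = Nat.card H := (Nat.subtype_card Hf (fun x => by simp [hHf])).symm
    rw [← hS'card, ← hHcard]
    exact Finset.card_le_card fun s hs => by simpa [hHf] using hS'H s hs
  have hmono : ((S.card * T.card * U.card : ℕ) : ℝ) ≤ ((Nat.card H * T.card * U.card : ℕ) : ℝ) := by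
    exact_mod_cast Nat.mul_le_mul_right _ (Nat.mul_le_mul_right _ hSH)
  exact hmono.trans key

/-- **No threshold family has a member filling half of a subgroup coset.**  `X` restricted to triples whose first set
lies in a right coset `H·a` with `|H| < 2|S|` is false: at `c := c₂/4` and `n ≥ n₀` a witness would satisfy
`(n!)^{3/2}e^{-(c₂/4)√n} < |S||T||U| ≤ (n!)^{3/2}e^{-(c₂/2)√n}`.  (Whole subgroups, p139094, are the case `S = H`.) -/
theorem not_thresholdDenseMemberTriples : ¬ (∀ c : ℝ, 0 < c → ∀ n₀ : ℕ, ∃ n ≥ n₀, ∃ H : Subgroup (Equiv.Perm (Fin n)), ∃ a : Equiv.Perm (Fin n), ∃ S T U : Finset (Equiv.Perm (Fin n)), (∀ s ∈ S, s * a⁻¹ ∈ H) ∧ Nat.card H < 2 * S.card ∧ TripleProductProperty S T U ∧ (n.factorial : ℝ) ^ ((3 : ℝ) / 2) * Real.exp (-(c * Real.sqrt (n : ℝ))) < ((S.card * T.card * U.card : ℕ) : ℝ)) := by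
  intro h
  obtain ⟨n₁, hcap⟩ := denseMember_cap
  have hc2 : 0 < vkUpperConst := vkUpperConst_pos
  obtain ⟨n, hn, H, a, S, T, U, hS, hdense, hT, hbig⟩ := h (vkUpperConst / 4) (by linarith) n₁
  have hcapn := hcap n hn H a S T U hS hdense hT
  have hexp : Real.exp (-(vkUpperConst / 2 * Real.sqrt (n : ℝ))) ≤
      Real.exp (-(vkUpperConst / 4 * Real.sqrt (n : ℝ))) := by
    apply Real.exp_le_exp.2
    have hsq : 0 ≤ Real.sqrt (n : ℝ) := Real.sqrt_nonneg _
    nlinarith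
  have hF : (0 : ℝ) ≤ (n.factorial : ℝ) ^ ((3 : ℝ) / 2) := by positivity
  have hle := mul_le_mul_of_nonneg_left hexp hF
  linarith

end Summit.MatrixMultiplication.MatrixMultiplication.Theorems.ThresholdSubsetTriples.Negative
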